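import Summits.NavierStokesRegularity.NavierStokesRegularity.Theorems.AdaptedFrequencyTangentFlowTransferWindowRegularity
import Summits.NavierStokesRegularity.NavierStokesRegularity.Theorems.SqueezeCycleExtremalElementExistsExtraction
import HarnessLib

/-!
# `C²_loc` compactness on expanding windows, I: uniform convergence of `(w, ∇w, ∇²w)` on pieces
# (route `AdaptedFrequency`, item `TangentFlowTransfer`, stmt-NavierStokesRegularity-10494)

Helper file (all results proved): the windowed, second-order twin of
`exists_tendsto_of_isTypeIAncientMild_seq` (`SqueezeCycleExtremalElementExistsExtraction`). Let
`w k` be jointly continuous on `(A_k, 0) × ℝ³`, weakly divergence free, Oseen-mild between all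
times `A_k < s < t < 0` and Type-I bounded with a common constant `C`, where `A_k → −∞` (the zoomed
blow-up sequence of a Type-I solution, made Oseen-mild by `mild_of_bounded_of_eLpNorm_two_le_of_lt`
and normalised to unit viscosity). Then along a subsequence `φ` the fields, their gradients
**and their second derivatives** converge locally uniformly on every slice `t < 0` to an ancient
field `W` of the Type-I class `IsTypeIAncientMild C` and to its derivatives
(`exists_tendsto_of_typeI_oseenMild_windows`):

1. on the compact pieces `[−(n+2), −1/(n+2)] × B̄(0, n+2)` the triples `(w k, ∇w k, ∇²w k)` are,
   for all large `k`, bounded and uniformly Lipschitz (the windowed class-uniform bounds on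
   `w, ∇w, ∇²w, ∇³w` and the time-Lipschitz moduli of `w, ∇w, ∇²w`,
   `AdaptedFrequencyTangentFlowTransferWindowRegularity`);
2. diagonal Arzelà–Ascoli (`exists_strictMono_tendstoUniformlyOn_of_bound`) on the triple maps;
   locally uniform limits of derivatives are derivatives (`hasFDerivAt_of_tendstoLocallyUniformlyOn`,
   twice);
3. Type-I bound, weak divergence-freeness and the Oseen equation pass to the limit along the
   tails `j ≥ j₀` on which the windows contain the times at hand, and `W ∈ IsTypeIAncientMild C`
   by `isTypeIAncientMild_of_continuous_oseenMild` (KNSS 2009, Prop. 4.1, Lemma 6.1).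
-/

noncomputable section

-- third-order derivatives are triply nested continuous linear maps `E →L (E →L (E →L E))`, whose
-- operator-norm instances need one more pending typeclass problem than the default allows
set_option maxSynthPendingDepth 2

open MeasureTheory Set Function Filter TopologicalSpace Metric
open scoped Topology NNReal ENNReal InnerProductSpace RealInnerProductSpace

namespace Summit.NavierStokesRegularity.NavierStokesRegularity.Theorems

open Literature.Analysis Literature.Analysis.FluidPDE

section Norms

variable {E F : Type*} [NormedAddCommGroup E] [NormedSpace ℝ E] [NormedAddCommGroup F]
  [NormedSpace ℝ F]

/-- `‖D²f(x) − D²g(x)‖ = ‖D(Df)(x) − D(Dg)(x)‖` for `C²` maps (both sides are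
`‖D²(f − g)(x)‖`). [folklore] -/
theorem norm_iteratedFDeriv_two_sub {f g : E → F} (hf : ContDiff ℝ 2 f) (hg : ContDiff ℝ 2 g)
    (x : E) :
    ‖iteratedFDeriv ℝ 2 f x - iteratedFDeriv ℝ 2 g x‖ =
      ‖fderiv ℝ (fderiv ℝ f) x - fderiv ℝ (fderiv ℝ g) x‖ := by
  have hfd : ∀ y, DifferentiableAt ℝ f y := fun y => (hf.differentiable (by norm_num)) y
  have hgd : ∀ y, DifferentiableAt ℝ g y := fun y => (hg.differentiable (by norm_num)) y
  have hf1 : ContDiff ℝ 1 (fderiv ℝ f) := hf.fderiv_right (m := 1) (by norm_cast)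
  have hg1 : ContDiff ℝ 1 (fderiv ℝ g) := hg.fderiv_right (m := 1) (by norm_cast)
  rw [← iteratedFDeriv_sub_apply hf.contDiffAt hg.contDiffAt,
    ← FunctionSpaces.norm_fderiv_fderiv_eq_norm_iteratedFDeriv_two]
  have h1 : fderiv ℝ (f - g) = fderiv ℝ f - fderiv ℝ g := by
    funext y; exact fderiv_sub (hfd y) (hgd y)
  rw [h1, fderiv_sub ((hf1.differentiable one_ne_zero) x) ((hg1.differentiable one_ne_zero) x)]

/-- `‖D(D(Df))(x)‖ = ‖D³f(x)‖`. [folklore] -/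
theorem norm_fderiv_fderiv_fderiv_eq_norm_iteratedFDeriv_three (f : E → F) (x : E) :
    ‖fderiv ℝ (fderiv ℝ (fderiv ℝ f)) x‖ = ‖iteratedFDeriv ℝ 3 f x‖ := by
  rw [FunctionSpaces.norm_fderiv_fderiv_eq_norm_iteratedFDeriv_two (fderiv ℝ f) x,
    norm_iteratedFDeriv_fderiv]

/-- Uniform convergence along `atTop` is preserved by shifting the index. [folklore] -/
theorem tendstoUniformlyOn_add_atTop {X Y : Type*} [PseudoMetricSpace Y] {F : ℕ → X → Y} {f : X → Y}
    {s : Set X} (h : TendstoUniformlyOn F f atTop s) (j₀ : ℕ) :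
    TendstoUniformlyOn (fun j => F (j + j₀)) f atTop s := by
  rw [Metric.tendstoUniformlyOn_iff] at h ⊢
  intro ε hε
  exact (tendsto_add_atTop_nat j₀).eventually (h ε hε)

end Norms

section Compactness

/-- **Step 1–3 of the extraction: uniform convergence of the triples `(w, ∇w, ∇²w)` on the slab
pieces along a subsequence** (windowed class-uniform bounds and moduli, diagonal Arzelà–Ascoli).
[cite: KochNadirashviliSereginSverak2009, Lemma 6.1 and Prop. 4.1 (arXiv:0709.3599 pp. 8, 11)] -/
theorem exists_tendstoUniformlyOn_triple_of_typeI_oseenMild_windows {C : ℝ} (hC : 0 ≤ C) {A : ℕ → ℝ}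
    (hA : Tendsto A atTop atBot) {w : ℕ → ℝ → EuclideanSpace ℝ (Fin 3) → EuclideanSpace ℝ (Fin 3)}
    (hc : ∀ k, ContinuousOn (uncurry (w k)) (Ioo (A k) 0 ×ˢ univ))
    (hdivw : ∀ k, ∀ t ∈ Ioo (A k) 0, IsWeaklyDivFree (w k t))
    (hmild : ∀ k, ∀ s t : ℝ, A k < s → s < t → t < 0 → ∀ x,
      w k t x = UnboundedOperators.heatExtension (w k s) (t - s) x - oseenDuhamel 1 s (w k) (w k) t x)
    (hI : ∀ k, ∀ t ∈ Ioo (A k) 0, ∀ x, ‖w k t x‖ ≤ C / Real.sqrt (-t)) :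
    ∃ φ : ℕ → ℕ, StrictMono φ ∧
      ∃ (W : ℝ → EuclideanSpace ℝ (Fin 3) → EuclideanSpace ℝ (Fin 3))
        (G : ℝ → EuclideanSpace ℝ (Fin 3) → (EuclideanSpace ℝ (Fin 3) →L[ℝ] EuclideanSpace ℝ (Fin 3)))
        (Hs : ℝ → EuclideanSpace ℝ (Fin 3) →
          (EuclideanSpace ℝ (Fin 3) →L[ℝ] EuclideanSpace ℝ (Fin 3) →L[ℝ] EuclideanSpace ℝ (Fin 3))),
        (∀ n : ℕ, TendstoUniformlyOn (fun j z => w (φ j) z.1 z.2) (fun z => W z.1 z.2) atTop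
          (Icc (-((n : ℝ) + 2)) (-(1 / ((n : ℝ) + 2))) ×ˢ
            closedBall (0 : EuclideanSpace ℝ (Fin 3)) ((n : ℝ) + 2))) ∧
        (∀ n : ℕ, TendstoUniformlyOn (fun j z => fderiv ℝ (w (φ j) z.1) z.2) (fun z => G z.1 z.2) atTop
          (Icc (-((n : ℝ) + 2)) (-(1 / ((n : ℝ) + 2))) ×ˢ
            closedBall (0 : EuclideanSpace ℝ (Fin 3)) ((n : ℝ) + 2))) ∧
        (∀ n : ℕ, TendstoUniformlyOn (fun j z => fderiv ℝ (fderiv ℝ (w (φ j) z.1)) z.2)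
          (fun z => Hs z.1 z.2) atTop
          (Icc (-((n : ℝ) + 2)) (-(1 / ((n : ℝ) + 2))) ×ˢ
            closedBall (0 : EuclideanSpace ℝ (Fin 3)) ((n : ℝ) + 2))) := by
  -- ## Step 0: per-`k` facts on the windows
  have hsm : ∀ k, ContDiffOn ℝ (⊤ : ℕ∞) (uncurry (w k)) (Ioo (A k) 0 ×ˢ univ) := fun k =>
    contDiffOn_window_slab (hc k) (hdivw k) (hmild k) hC (hI k)
  have hDc : ∀ k, ContinuousOn (fun z : ℝ × EuclideanSpace ℝ (Fin 3) => fderiv ℝ (w k z.1) z.2)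
      (Ioo (A k) 0 ×ˢ univ) := fun k =>
    IsSmoothSpaceTimeOn.continuousOn_fderiv_slice (S := Ioo (A k) 0) (w := w k) (hsm k)
      isOpen_Ioo.uniqueDiffOn
  have hDDc : ∀ k, ContinuousOn
      (fun z : ℝ × EuclideanSpace ℝ (Fin 3) => fderiv ℝ (fderiv ℝ (w k z.1)) z.2)
      (Ioo (A k) 0 ×ˢ univ) := fun k =>
    IsSmoothSpaceTimeOn.continuousOn_fderiv_slice (S := Ioo (A k) 0)
      (w := fun t x => fderiv ℝ (w k t) x)
      (IsSmoothSpaceTimeOn.fderiv_slice (S := Ioo (A k) 0) (w := w k) (hsm k) isOpen_Ioo.uniqueDiffOn)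
      isOpen_Ioo.uniqueDiffOn
  have hsmooth : ∀ k, ∀ t ∈ Ioo (A k) 0, ContDiff ℝ ((⊤ : ℕ∞) : WithTop ℕ∞) (w k t) := fun k t ht =>
    IsSmoothSpaceTimeOn.contDiff_slice (hsm k) ht
  have hdiff : ∀ k, ∀ t ∈ Ioo (A k) 0, Differentiable ℝ (w k t) := fun k t ht =>
    (hsmooth k t ht).differentiable (by simp)
  have hsmooth2 : ∀ k, ∀ t ∈ Ioo (A k) 0, ContDiff ℝ 2 (w k t) := fun k t ht =>
    (hsmooth k t ht).of_le (by norm_cast)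
  have hdiff2 : ∀ k, ∀ t ∈ Ioo (A k) 0, Differentiable ℝ (fderiv ℝ (w k t)) := fun k t ht =>
    ((hsmooth k t ht).fderiv_right (m := 1) (by norm_cast)).differentiable (by simp)
  have hdiff3 : ∀ k, ∀ t ∈ Ioo (A k) 0, Differentiable ℝ (fderiv ℝ (fderiv ℝ (w k t))) :=
    fun k t ht =>
    ((((hsmooth k t ht).fderiv_right (m := 2) (by norm_cast)).fderiv_right (m := 1)
      (by norm_cast))).differentiable (by simp)
  have hslice : ∀ k, ∀ t ∈ Ioo (A k) 0, Continuous (w k t) := fun k t ht => (hdiff k t ht).continuous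
  -- ## Step 1: windows, pieces and class-uniform constants
  set a : ℕ → ℝ := fun n => -((n : ℝ) + 3) with ha
  set b : ℕ → ℝ := fun n => -(1 / (2 * ((n : ℝ) + 2))) with hb
  have hab : ∀ n, a n < b n := fun n => by
    have : (0 : ℝ) < 1 / (2 * ((n : ℝ) + 2)) := by positivity
    have h2 : 1 / (2 * ((n : ℝ) + 2)) ≤ 1 := by
      rw [div_le_one (by positivity)]; linarith [(Nat.cast_nonneg n : (0 : ℝ) ≤ n)]
    simp only [ha, hb]; linarith [(Nat.cast_nonneg n : (0 : ℝ) ≤ n)]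
  have hb0 : ∀ n, b n < 0 := fun n => by
    have : (0 : ℝ) < 1 / (2 * ((n : ℝ) + 2)) := by positivity
    simp only [hb]; linarith
  have hab1 : ∀ n, a n + 1 < b n := fun n => by
    have h2 : 1 / (2 * ((n : ℝ) + 2)) ≤ 1 := by
      rw [div_le_one (by positivity)]; linarith [(Nat.cast_nonneg n : (0 : ℝ) ≤ n)]
    simp only [ha, hb]; linarith [(Nat.cast_nonneg n : (0 : ℝ) ≤ n)]
  set T : ℕ → Set (ℝ × EuclideanSpace ℝ (Fin 3)) := fun n =>
    Icc (-((n : ℝ) + 2)) (-(1 / ((n : ℝ) + 2))) ×ˢ closedBall (0 : EuclideanSpace ℝ (Fin 3)) ((n : ℝ) + 2)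
    with hT
  have hTwin : ∀ n, ∀ z ∈ T n, z.1 ∈ Ico (a n + 1) (b n) := fun n z hz => by
    obtain ⟨⟨h1, h2⟩, -⟩ := mem_slabPiece.1 hz
    have hn2 : (0 : ℝ) < (n : ℝ) + 2 := by positivity
    refine ⟨by simp only [ha]; linarith, lt_of_le_of_lt h2 ?_⟩
    simp only [hb]
    rw [neg_lt_neg_iff, div_lt_div_iff_of_pos_left one_pos (by positivity) hn2]
    linarith
  have hTneg : ∀ n, ∀ z ∈ T n, z.1 < 0 := fun n z hz => ((hTwin n z hz).2).trans (hb0 n)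
  -- windows eventually contain the pieces
  have hgood : ∀ n, ∀ᶠ k in atTop, A k < a n := fun n => hA.eventually (eventually_lt_atBot (a n))
  have hTA : ∀ n k, A k < a n → ∀ z ∈ T n, z.1 ∈ Ioo (A k) 0 := fun n k hk z hz =>
    ⟨hk.trans (by linarith [(hTwin n z hz).1]), hTneg n z hz⟩
  -- constants
  have e0 := fun n : ℕ => exists_norm_iteratedFDeriv_le_of_typeI_window hC 0 (hab n) (hb0 n) one_pos
  have e1 := fun n : ℕ => exists_norm_iteratedFDeriv_le_of_typeI_window hC 1 (hab n) (hb0 n) one_pos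
  have e2 := fun n : ℕ => exists_norm_iteratedFDeriv_le_of_typeI_window hC 2 (hab n) (hb0 n) one_pos
  have e3 := fun n : ℕ => exists_norm_iteratedFDeriv_le_of_typeI_window hC 3 (hab n) (hb0 n) one_pos
  have l0 := fun n : ℕ => exists_lipschitz_time_of_typeI_window hC 0 (hab n) (hb0 n) one_pos
  have l1 := fun n : ℕ => exists_lipschitz_time_of_typeI_window hC 1 (hab n) (hb0 n) one_pos
  have l2 := fun n : ℕ => exists_lipschitz_time_of_typeI_window hC 2 (hab n) (hb0 n) one_pos
  choose K0 hK0 using e0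
  choose K1 hK1 using e1
  choose K2 hK2 using e2
  choose K3 hK3 using e3
  choose L0 hL00 hL0 using l0
  choose L1 hL10 hL1 using l1
  choose L2 hL20 hL2 using l2
  -- pointwise bounds on the pieces, for every good `k`
  have hB0 : ∀ n k, A k < a n → ∀ z ∈ T n, ‖w k z.1 z.2‖ ≤ K0 n := fun n k hk z hz => by
    have h := hK0 n hk (hc k) (hdivw k) (hmild k) (hI k) z.1 (hTwin n z hz) z.2
    rwa [norm_iteratedFDeriv_zero] at h
  have hB1 : ∀ n k, A k < a n → ∀ t ∈ Ico (a n + 1) (b n), ∀ x, ‖fderiv ℝ (w k t) x‖ ≤ K1 n :=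
    fun n k hk t ht x => by
    have h := hK1 n hk (hc k) (hdivw k) (hmild k) (hI k) t ht x
    rwa [norm_iteratedFDeriv_one] at h
  have hB2 : ∀ n k, A k < a n → ∀ t ∈ Ico (a n + 1) (b n), ∀ x,
      ‖fderiv ℝ (fderiv ℝ (w k t)) x‖ ≤ K2 n := fun n k hk t ht x => by
    have h := hK2 n hk (hc k) (hdivw k) (hmild k) (hI k) t ht x
    rwa [← FunctionSpaces.norm_fderiv_fderiv_eq_norm_iteratedFDeriv_two] at h
  have hB3 : ∀ n k, A k < a n → ∀ t ∈ Ico (a n + 1) (b n), ∀ x,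
      ‖fderiv ℝ (fderiv ℝ (fderiv ℝ (w k t))) x‖ ≤ K3 n := fun n k hk t ht x => by
    have h := hK3 n hk (hc k) (hdivw k) (hmild k) (hI k) t ht x
    rwa [← norm_fderiv_fderiv_fderiv_eq_norm_iteratedFDeriv_three] at h
  have hK1nn : ∀ n, 0 ≤ K1 n := fun n => by
    obtain ⟨k, hk⟩ := (hgood n).exists
    exact (norm_nonneg _).trans (hB1 n k hk (a n + 1) ⟨le_rfl, hab1 n⟩ 0)
  have hK2nn : ∀ n, 0 ≤ K2 n := fun n => by
    obtain ⟨k, hk⟩ := (hgood n).exists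
    exact (norm_nonneg (fderiv ℝ (fderiv ℝ (w k (a n + 1))) 0)).trans (hB2 n k hk (a n + 1) ⟨le_rfl, hab1 n⟩ 0)
  have hK3nn : ∀ n, 0 ≤ K3 n := fun n => by
    obtain ⟨k, hk⟩ := (hgood n).exists
    exact (norm_nonneg (fderiv ℝ (fderiv ℝ (fderiv ℝ (w k (a n + 1)))) 0)).trans
      (hB3 n k hk (a n + 1) ⟨le_rfl, hab1 n⟩ 0)
  -- ## Step 2: the triple maps and their moduli on the pieces
  set V : ℕ → ℝ × EuclideanSpace ℝ (Fin 3) →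
      EuclideanSpace ℝ (Fin 3) × (EuclideanSpace ℝ (Fin 3) →L[ℝ] EuclideanSpace ℝ (Fin 3)) ×
        (EuclideanSpace ℝ (Fin 3) →L[ℝ] EuclideanSpace ℝ (Fin 3) →L[ℝ] EuclideanSpace ℝ (Fin 3)) :=
    fun k z => (w k z.1 z.2, fderiv ℝ (w k z.1) z.2, fderiv ℝ (fderiv ℝ (w k z.1)) z.2) with hV
  set Rn : ℕ → ℝ := fun n => max (K0 n) (max (K1 n) (K2 n)) with hRn
  set Kn : ℕ → ℝ := fun n => (K1 n + L0 n) + (K2 n + L1 n) + (K3 n + L2 n) with hKn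
  have hKn0 : ∀ n, 0 ≤ Kn n := fun n => by
    simp only [hKn]; linarith [hK1nn n, hL00 n, hK2nn n, hL10 n, hK3nn n, hL20 n]
  have hVn : ∀ n : ℕ, ∀ᶠ k in atTop, ContinuousOn (V k) (T n) ∧
      (∀ z ∈ T n, ‖V k z‖ ≤ Rn n) ∧
      ∀ z ∈ T n, ∀ z' ∈ T n, dist (V k z) (V k z') ≤ Kn n * dist z z' ^ (1 : ℝ) := by
    intro n
    filter_upwards [hgood n] with k hk
    have hsub : T n ⊆ Ioo (A k) 0 ×ˢ univ := fun z hz => ⟨hTA n k hk z hz, mem_univ _⟩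
    refine ⟨((hc k).mono hsub).prodMk (((hDc k).mono hsub).prodMk ((hDDc k).mono hsub)),
      fun z hz => ?_, fun z hz z' hz' => ?_⟩
    · rw [hV, Prod.norm_mk, Prod.norm_mk]
      exact max_le_max (hB0 n k hk z hz) (max_le_max (hB1 n k hk z.1 (hTwin n z hz) z.2)
        (hB2 n k hk z.1 (hTwin n z hz) z.2))
    · rw [Real.rpow_one]
      have ht := hTwin n z hz
      have ht' := hTwin n z' hz'
      have htI := hTA n k hk z hz
      have hdt : |z.1 - z'.1| ≤ dist z z' := by
        rw [← Real.dist_eq, Prod.dist_eq]; exact le_max_left _ _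
      have hdx : ‖z.2 - z'.2‖ ≤ dist z z' := by
        rw [← dist_eq_norm, Prod.dist_eq]; exact le_max_right _ _
      have hd0 : 0 ≤ dist z z' := dist_nonneg
      -- values
      have hv1 : ‖w k z.1 z.2 - w k z.1 z'.2‖ ≤ K1 n * ‖z.2 - z'.2‖ :=
        (convex_univ.norm_image_sub_le_of_norm_fderiv_le (fun x _ => (hdiff k z.1 htI) x)
          (fun x _ => hB1 n k hk z.1 ht x) (mem_univ z'.2) (mem_univ z.2))
      have hv2 : ‖w k z.1 z'.2 - w k z'.1 z'.2‖ ≤ L0 n * |z.1 - z'.1| := by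
        have h := hL0 n hk (hc k) (hdivw k) (hmild k) (hI k) z'.1 ht' z.1 ht z'.2
        rwa [DerivInterp.norm_iteratedFDeriv_zero_sub] at h
      have hval : ‖w k z.1 z.2 - w k z'.1 z'.2‖ ≤ (K1 n + L0 n) * dist z z' := by
        calc ‖w k z.1 z.2 - w k z'.1 z'.2‖
            ≤ ‖w k z.1 z.2 - w k z.1 z'.2‖ + ‖w k z.1 z'.2 - w k z'.1 z'.2‖ :=
              norm_sub_le_norm_sub_add_norm_sub _ _ _
          _ ≤ K1 n * dist z z' + L0 n * dist z z' := add_le_add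
              (hv1.trans (mul_le_mul_of_nonneg_left hdx (hK1nn n)))
              (hv2.trans (mul_le_mul_of_nonneg_left hdt (hL00 n)))
          _ = (K1 n + L0 n) * dist z z' := by ring
      -- gradients
      have hg1 : ‖fderiv ℝ (w k z.1) z.2 - fderiv ℝ (w k z.1) z'.2‖ ≤ K2 n * ‖z.2 - z'.2‖ :=
        (convex_univ.norm_image_sub_le_of_norm_fderiv_le
          (fun x _ => (hdiff2 k z.1 htI) x)
          (fun x _ => hB2 n k hk z.1 ht x) (mem_univ z'.2) (mem_univ z.2))
      have hg2 : ‖fderiv ℝ (w k z.1) z'.2 - fderiv ℝ (w k z'.1) z'.2‖ ≤ L1 n * |z.1 - z'.1| := by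
        have h := hL1 n hk (hc k) (hdivw k) (hmild k) (hI k) z'.1 ht' z.1 ht z'.2
        rwa [norm_iteratedFDeriv_one_sub] at h
      have hgrad : ‖fderiv ℝ (w k z.1) z.2 - fderiv ℝ (w k z'.1) z'.2‖ ≤ (K2 n + L1 n) * dist z z' := by
        calc ‖fderiv ℝ (w k z.1) z.2 - fderiv ℝ (w k z'.1) z'.2‖
            ≤ ‖fderiv ℝ (w k z.1) z.2 - fderiv ℝ (w k z.1) z'.2‖ +
                ‖fderiv ℝ (w k z.1) z'.2 - fderiv ℝ (w k z'.1) z'.2‖ :=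
              norm_sub_le_norm_sub_add_norm_sub _ _ _
          _ ≤ K2 n * dist z z' + L1 n * dist z z' := add_le_add
              (hg1.trans (mul_le_mul_of_nonneg_left hdx (hK2nn n)))
              (hg2.trans (mul_le_mul_of_nonneg_left hdt (hL10 n)))
          _ = (K2 n + L1 n) * dist z z' := by ring
      -- second derivatives
      have hh1 : ‖fderiv ℝ (fderiv ℝ (w k z.1)) z.2 - fderiv ℝ (fderiv ℝ (w k z.1)) z'.2‖ ≤
          K3 n * ‖z.2 - z'.2‖ :=
        (convex_univ.norm_image_sub_le_of_norm_fderiv_le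
          (fun x _ => (hdiff3 k z.1 htI) x)
          (fun x _ => hB3 n k hk z.1 ht x) (mem_univ z'.2) (mem_univ z.2))
      have hh2 : ‖fderiv ℝ (fderiv ℝ (w k z.1)) z'.2 - fderiv ℝ (fderiv ℝ (w k z'.1)) z'.2‖ ≤
          L2 n * |z.1 - z'.1| := by
        have h := hL2 n hk (hc k) (hdivw k) (hmild k) (hI k) z'.1 ht' z.1 ht z'.2
        rwa [norm_iteratedFDeriv_two_sub (hsmooth2 k z.1 htI) (hsmooth2 k z'.1 (hTA n k hk z' hz'))] at h
      have hhess : ‖fderiv ℝ (fderiv ℝ (w k z.1)) z.2 - fderiv ℝ (fderiv ℝ (w k z'.1)) z'.2‖ ≤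
          (K3 n + L2 n) * dist z z' := by
        calc ‖fderiv ℝ (fderiv ℝ (w k z.1)) z.2 - fderiv ℝ (fderiv ℝ (w k z'.1)) z'.2‖
            ≤ ‖fderiv ℝ (fderiv ℝ (w k z.1)) z.2 - fderiv ℝ (fderiv ℝ (w k z.1)) z'.2‖ +
                ‖fderiv ℝ (fderiv ℝ (w k z.1)) z'.2 - fderiv ℝ (fderiv ℝ (w k z'.1)) z'.2‖ :=
              norm_sub_le_norm_sub_add_norm_sub _ _ _
          _ ≤ K3 n * dist z z' + L2 n * dist z z' := add_le_add
              (hh1.trans (mul_le_mul_of_nonneg_left hdx (hK3nn n)))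
              (hh2.trans (mul_le_mul_of_nonneg_left hdt (hL20 n)))
          _ = (K3 n + L2 n) * dist z z' := by ring
      rw [hV, dist_eq_norm, Prod.mk_sub_mk, Prod.mk_sub_mk, Prod.norm_mk, Prod.norm_mk]
      have h1 : K1 n + L0 n ≤ Kn n := by simp only [hKn]; linarith [hK2nn n, hL10 n, hK3nn n, hL20 n]
      have h2 : K2 n + L1 n ≤ Kn n := by simp only [hKn]; linarith [hK1nn n, hL00 n, hK3nn n, hL20 n]
      have h3 : K3 n + L2 n ≤ Kn n := by simp only [hKn]; linarith [hK1nn n, hL00 n, hK2nn n, hL10 n]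
      exact max_le (hval.trans (mul_le_mul_of_nonneg_right h1 hd0))
        (max_le (hgrad.trans (mul_le_mul_of_nonneg_right h2 hd0))
          (hhess.trans (mul_le_mul_of_nonneg_right h3 hd0)))
  -- ## Step 3: extraction
  obtain ⟨φ, hφ, P, hP⟩ := exists_strictMono_tendstoUniformlyOn_of_bound
    (fun n => isCompact_slabPiece (E := EuclideanSpace ℝ (Fin 3)) n) hKn0 (fun _ => one_pos) hVn
  set W : ℝ → EuclideanSpace ℝ (Fin 3) → EuclideanSpace ℝ (Fin 3) := fun t x => (P (t, x)).1 with hWdef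
  set G : ℝ → EuclideanSpace ℝ (Fin 3) → (EuclideanSpace ℝ (Fin 3) →L[ℝ] EuclideanSpace ℝ (Fin 3)) :=
    fun t x => (P (t, x)).2.1 with hGdef
  set Hs : ℝ → EuclideanSpace ℝ (Fin 3) →
      (EuclideanSpace ℝ (Fin 3) →L[ℝ] EuclideanSpace ℝ (Fin 3) →L[ℝ] EuclideanSpace ℝ (Fin 3)) :=
    fun t x => (P (t, x)).2.2 with hHdef
  have hW0 : ∀ n, TendstoUniformlyOn (fun j z => w (φ j) z.1 z.2) (fun z => W z.1 z.2) atTop (T n) :=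
    fun n => by
    have h : TendstoUniformlyOn (fun j => Prod.fst ∘ V (φ j)) (Prod.fst ∘ P) atTop (T n) :=
      uniformContinuous_fst.comp_tendstoUniformlyOn (hP n)
    exact (h.congr (Eventually.of_forall fun j => fun z _ => rfl)).congr_right fun z _ => rfl
  have hG0 : ∀ n, TendstoUniformlyOn (fun j z => fderiv ℝ (w (φ j) z.1) z.2) (fun z => G z.1 z.2) atTop
      (T n) := fun n => by
    have h : TendstoUniformlyOn (fun j => (Prod.fst ∘ Prod.snd) ∘ V (φ j)) ((Prod.fst ∘ Prod.snd) ∘ P)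
        atTop (T n) :=
      (uniformContinuous_fst.comp uniformContinuous_snd).comp_tendstoUniformlyOn (hP n)
    exact (h.congr (Eventually.of_forall fun j => fun z _ => rfl)).congr_right fun z _ => rfl
  have hH0 : ∀ n, TendstoUniformlyOn (fun j z => fderiv ℝ (fderiv ℝ (w (φ j) z.1)) z.2)
      (fun z => Hs z.1 z.2) atTop (T n) := fun n => by
    have h : TendstoUniformlyOn (fun j => (Prod.snd ∘ Prod.snd) ∘ V (φ j)) ((Prod.snd ∘ Prod.snd) ∘ P)
        atTop (T n) :=
      (uniformContinuous_snd.comp uniformContinuous_snd).comp_tendstoUniformlyOn (hP n)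
    exact (h.congr (Eventually.of_forall fun j => fun z _ => rfl)).congr_right fun z _ => rfl
  exact ⟨φ, hφ, W, G, Hs, hW0, hG0, hH0⟩

end Compactness

end Summit.NavierStokesRegularity.NavierStokesRegularity.Theorems

end
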